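import Literature.Analysis.FluidPDE.TaoCascadeRescaled
import Mathlib.Analysis.Calculus.ContDiff.Operations
import Mathlib.Analysis.Calculus.Deriv.Comp
import Mathlib.Analysis.Calculus.Deriv.Mul
import Mathlib.Analysis.Calculus.Deriv.Add
import Mathlib.MeasureTheory.Integral.IntervalIntegral.Basic
import HarnessLib

/-!
# Tao's cascade ODE: Prop. 6.5 with `K` allowed to depend on the constant of (6.53), and Prop. 6.5 ⇒ Prop. 6.4

T. Tao, *Finite time blowup for an averaged three-dimensional Navier–Stokes equation*,
J. Amer. Math. Soc. **29** (2016), 601–674 = arXiv:1402.0290v3, §6.4 (equation numbers of arXiv v3,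
as in `TaoCascadeRescaled.lean`). This file complements `TaoCascadeRescaled.lean`
(`RescaledHypotheses γ`, `RescaledConclusion γ`, `rescaledStepWith γ` = Prop. 6.5 with the
`X₃`-coefficient `γ`) in two ways.

* **Order of quantifiers.** `rescaledStepWith γ` chooses `K₀` (and `e₀`) uniformly in the implied
  constant `C₃` of the hypothesis (6.53) (`∃ K₀ … ∃ e₀ … ∀ C₁ C₂ C₃, ∃ N₀`). The printed proof does
  not give this uniformity: §6.1 declares "we allow all implied constants in the `O()` notation to
  depend on `ε₀`", so the constant of (6.53) is an `ε₀`-level quantity, and the proof of Prop. 6.13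
  uses that `K` dominates it — the constant of the crude bound (6.120)
  `Ẽ₁(t) ≲ K^{-30}/(1+|t|³)` (obtained "from this and (6.53)") is polynomial in that of (6.53), it
  propagates to (6.123) and to the bound `|b₁(t)| ≲ K^{-30} ε/(1+|t|²)` for `t ≤ 0`, and the
  bootstrap (6.121)–(6.122) is then closed by "this is inconsistent with (6.122) if `K` is
  [large] enough". (Without it the rescaled past `[τ_{n₀-N}, 0]` may be arbitrarily long compared
  with `K`, and `∫_{τ_{n₀-N}}^0 |b₁| ≤ ε/10` is not available.) We therefore also vendor
  `rescaledStepWith' γ`: the same statement with `C₃` quantified right after `ε₀`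
  (`∀ ε₀, ∀ C₃ ≥ 0, ∃ K₀, ∀ K ≥ K₀, ∃ e₀ > 0, ∀ ε ∈ (0,e₀], ∀ C₁ C₂ ≥ 0, ∃ N₀, …`), which is implied by
  `rescaledStepWith γ` (`rescaledStepWith.weaken`) and is what §6.5–6.7 establish (for the
  corrected coefficient: `rescaledStepCorrected'`); it suffices for Prop. 6.4 because the rescaling
  produces the specific constant `C₃ = tauConst ε₀` (below), a function of `ε₀` alone. (Verdict
  clean-up 2026-08-15: the closed uniform instances `rescaledStepCorrected`, `rescaledStepPrinted` of
  `TaoCascadeRescaled.lean` are deprecated in favour of `rescaledStepCorrected'`; the two theorems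
  here that took `(h : rescaledStepCorrected)` now take its body
  `rescaledStepWith (fun K => 10⁻⁵ exp(-K¹⁰/2))`, under the same names.)
* **Prop. 6.5 ⇒ Prop. 6.4** (the paragraph "Let us now explain why Proposition 6.5 implies
  Proposition 6.4", p. 59 of arXiv v3): the rescaling (6.82)–(6.84) (`rescScale`, `rescTime`,
  `rescMode`, `rescEnergy`), the verification that a solution of (6.1)–(6.10) with checkpoints
  (6.11)–(6.27)_γ rescales to `RescaledHypotheses γ … (tauConst ε₀) …`
  (`TaoODESystem.rescaledHypotheses`: chain rule for one-sided derivatives, change of variables in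
  the cumulative energy, the weight `(1+ε₀)^{2k-N/2} e_N⁻¹ ≤ (1+ε₀)^{2k-n₀/2}`, the geometric series
  behind (6.53), the amplitude ratios (6.84)), and the un-rescaling of the conclusion
  (`StateBoundsWith.unscale`, `StepBounds.unscale`), whence
  `blowupDynamicsStepWith_of_rescaledStepWith'` and, for `γ ≥ 0`, Thm. 6.2
  (`noGlobalODESolution_of_rescaledStepWith'`; corrected instance
  `noGlobalODESolution_of_rescaledStepCorrected'`), as well as the same for `rescaledStepWith γ`.

## References

* T. Tao, J. Amer. Math. Soc. 29 (2016), 601–674, arXiv:1402.0290v3: §6.1 (conventions on implied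
  constants), §6.4 Prop. 6.5, (6.82)–(6.84) and p. 59, §6.6 Prop. 6.13, (6.120)–(6.125).
  [`Tao2016AveragedNS`]
-/

noncomputable section

open Set MeasureTheory

namespace Literature.Analysis.FluidPDE

namespace TaoCascade

/-! ## Prop. 6.5 with `C₃` quantified before `K₀` -/

/-- **Tao's Prop. 6.5 with `X₃`-coefficient `γ`, the implied constant `C₃` of (6.53) being fixed
before `K₀` is chosen** (see the module docstring): for `0 < ε₀ < 1` and `C₃ ≥ 0` there is `K₀` such
that for `K ≥ K₀`, `K > 0`, there is `e₀ > 0` such that for `0 < ε ≤ e₀` and implied constants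
`C₁, C₂ ≥ 0` of (6.45)–(6.48), (6.51) there is `N₀` such that for `n₀ ≥ N₀`, `N ≥ n₀` and data obeying
(i)–(ix) (`RescaledHypotheses (γ K) … C₁ C₂ C₃ …`) the conclusion (6.67)–(6.81)
(`RescaledConclusion (γ K)`) holds for some `τ₁, μ₁`. A statement schema (not asserted; vacuous for
`γ < 0` as `rescaledStepWith`). [cite: Tao2016AveragedNS, §6.4 Prop. 6.5] -/
def rescaledStepWith' (γ : ℝ → ℝ) : Prop :=
  ∀ ε₀ : ℝ, 0 < ε₀ → ε₀ < 1 → ∀ C₃ : ℝ, 0 ≤ C₃ →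
    ∃ K₀ : ℝ, ∀ K : ℝ, K₀ ≤ K → 0 < K →
      ∃ e₀ : ℝ, 0 < e₀ ∧ ∀ ε : ℝ, 0 < ε → ε ≤ e₀ →
        ∀ C₁ C₂ : ℝ, 0 ≤ C₁ → 0 ≤ C₂ →
          ∃ N₀ : ℤ, ∀ n₀ : ℤ, N₀ ≤ n₀ → ∀ N : ℤ, n₀ ≤ N →
            ∀ (τ : ℤ → ℝ) (Y : Fin 4 → ℤ → ℝ → ℝ) (F : ℤ → ℝ → ℝ),
              RescaledHypotheses (γ K) ε₀ K ε C₁ C₂ C₃ n₀ N τ Y F →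
                ∃ τ₁ μ₁ : ℝ, RescaledConclusion (γ K) ε₀ K ε n₀ Y F τ₁ μ₁

/-- **The corrected Prop. 6.5 (`exp(-K¹⁰/2)` in (6.56), (6.71)) with `C₃` before `K₀`**: the
statement which the bootstrap of §6.5–6.7 establishes. A named fact (not asserted).
[cite: Tao2016AveragedNS, §6.4 Prop. 6.5; §6.6 Prop. 6.13 (6.117)] -/
def rescaledStepCorrected' : Prop :=
  rescaledStepWith' fun K => 1 / 10 ^ 5 * Real.exp (-K ^ 10 / 2)

/-- `rescaledStepWith γ` (uniform in `C₃`) implies `rescaledStepWith' γ`.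
[cite: Tao2016AveragedNS, §6.4 Prop. 6.5] -/
theorem rescaledStepWith.weaken {γ : ℝ → ℝ} (h : rescaledStepWith γ) : rescaledStepWith' γ := by
  intro ε₀ hε₀ hε₀1 C₃ hC₃
  obtain ⟨K₀, hK⟩ := h ε₀ hε₀ hε₀1
  refine ⟨K₀, fun K hK₀K hKpos => ?_⟩
  obtain ⟨e₀, he₀, hε⟩ := hK K hK₀K hKpos
  refine ⟨e₀, he₀, fun ε hεpos hεle C₁ C₂ hC₁ hC₂ => ?_⟩
  obtain ⟨N₀, hN⟩ := hε ε hεpos hεle C₁ C₂ C₃ hC₁ hC₂ hC₃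
  exact ⟨N₀, hN⟩

/-- In particular the corrected-coefficient instance `rescaledStepWith (fun K => 10⁻⁵ exp(-K¹⁰/2))`
of the uniform schema implies `rescaledStepCorrected'`. (The hypothesis is the body of the closed name
`rescaledStepCorrected` of `TaoCascadeRescaled.lean`, deprecated on 2026-08-15 as mis-stated — `K₀`
uniform in `C₃`, see the module docstring — and therefore spelled out; the theorem keeps its name.)
[cite: Tao2016AveragedNS, §6.4 Prop. 6.5] -/
theorem rescaledStepCorrected.weaken
    (h : rescaledStepWith fun K => 1 / 10 ^ 5 * Real.exp (-K ^ 10 / 2)) : rescaledStepCorrected' :=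
  rescaledStepWith.weaken h

/-! ## The rescaling of §6.4 -/

/-- The time scale `(1+ε₀)^{-5N/2} e_N⁻¹` of the rescaling of §6.4 (the reciprocal of the factor
`(1+ε₀)^{5N/2} e_N` in (6.82)). [cite: Tao2016AveragedNS, §6.4 (6.82)] -/
def rescScale (ε₀ : ℝ) (e : ℤ → ℝ) (N : ℤ) : ℝ :=
  (1 + ε₀) ^ (-(5 : ℝ) * N / 2) * (e N)⁻¹

/-- The rescaled times (6.82) `τ_k := (1+ε₀)^{5N/2} e_N (t_{N+k} - t_N)` (a total function of
`k ∈ ℤ`). [cite: Tao2016AveragedNS, §6.4 (6.82)] -/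
def rescTime (ε₀ : ℝ) (t e : ℤ → ℝ) (N : ℤ) (k : ℤ) : ℝ :=
  (1 + ε₀) ^ ((5 : ℝ) * N / 2) * e N * (t (N + k) - t N)

/-- The rescaled modes `a_k(s) := e_N⁻¹ X_{1,N+k}(t_N + (1+ε₀)^{-5N/2} e_N⁻¹ s)`, …,
`d_k(s) := e_N⁻¹ X_{4,N+k}(…)` of §6.4 (display after (6.83)). [cite: Tao2016AveragedNS, §6.4 after (6.83)] -/
def rescMode (ε₀ : ℝ) (t e : ℤ → ℝ) (N : ℤ) (X : Fin 4 → ℤ → ℝ → ℝ) : Fin 4 → ℤ → ℝ → ℝ :=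
  fun i k s => (e N)⁻¹ * X i (N + k) (t N + rescScale ε₀ e N * s)

/-- The rescaled energies `Ẽ_k(s) := e_N⁻² E_{N+k}(t_N + (1+ε₀)^{-5N/2} e_N⁻¹ s)` of §6.4 (display
after (6.83)). [cite: Tao2016AveragedNS, §6.4 after (6.83)] -/
def rescEnergy (ε₀ : ℝ) (t e : ℤ → ℝ) (N : ℤ) (E : ℤ → ℝ → ℝ) : ℤ → ℝ → ℝ :=
  fun k s => (e N)⁻¹ ^ 2 * E (N + k) (t N + rescScale ε₀ e N * s)

/-- The implied constant of (6.53) produced by the rescaling: with `ρ = (1+ε₀)^{5/2+1/100}`,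
`C₃(ε₀) := 100 ρ / (ρ - 1)` (the sum of the geometric series in "from this, (6.14), (6.82) and
summing the geometric series we then obtain (6.53)"). [cite: Tao2016AveragedNS, §6.4 p. 34] -/
def tauConst (ε₀ : ℝ) : ℝ :=
  100 * (1 + ε₀) ^ ((5 : ℝ) / 2 + 1 / 100) / ((1 + ε₀) ^ ((5 : ℝ) / 2 + 1 / 100) - 1)


/-- `C₃(ε₀) ≥ 0` for `ε₀ > 0`. [cite: Tao2016AveragedNS, §6.4 p. 34] -/
theorem tauConst_nonneg {ε₀ : ℝ} (hε₀ : 0 < ε₀) : 0 ≤ tauConst ε₀ := by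
  have h1 : (1 : ℝ) < (1 + ε₀) ^ ((5 : ℝ) / 2 + 1 / 100) :=
    Real.one_lt_rpow (by linarith) (by norm_num)
  unfold tauConst
  exact div_nonneg (by positivity) (by linarith)

/-- The defining identity `C₃(ε₀) (ρ - 1) = 100 ρ`, `ρ = (1+ε₀)^{5/2+1/100}`.
[cite: Tao2016AveragedNS, §6.4 p. 34] -/
theorem tauConst_mul_sub_one {ε₀ : ℝ} (hε₀ : 0 < ε₀) :
    tauConst ε₀ * ((1 + ε₀) ^ ((5 : ℝ) / 2 + 1 / 100) - 1) =
      100 * (1 + ε₀) ^ ((5 : ℝ) / 2 + 1 / 100) := by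
  have h1 : (1 : ℝ) < (1 + ε₀) ^ ((5 : ℝ) / 2 + 1 / 100) :=
    Real.one_lt_rpow (by linarith) (by norm_num)
  unfold tauConst
  rw [div_mul_cancel₀ _ (by linarith)]

/-! ## Elementary facts about the rescaling maps -/

section Maps

variable {ε₀ : ℝ} {t e : ℤ → ℝ} {N : ℤ}

/-- The time scale is positive. [cite: Tao2016AveragedNS, §6.4 (6.82)] -/
theorem rescScale_pos (hε₀ : 0 < ε₀) (heN : 0 < e N) : 0 < rescScale ε₀ e N := by
  unfold rescScale
  have h0 : (0 : ℝ) < 1 + ε₀ := by linarith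
  positivity

/-- `(1+ε₀)^{-5N/2} e_N⁻¹ · ((1+ε₀)^{5N/2} e_N) = 1`. [cite: Tao2016AveragedNS, §6.4 (6.82)] -/
theorem rescScale_mul (hε₀ : 0 < ε₀) (heN : 0 < e N) :
    rescScale ε₀ e N * ((1 + ε₀) ^ ((5 : ℝ) * N / 2) * e N) = 1 := by
  unfold rescScale
  have h0 : (0 : ℝ) < 1 + ε₀ := by linarith
  have hq : (1 + ε₀) ^ (-(5 : ℝ) * N / 2) * (1 + ε₀) ^ ((5 : ℝ) * N / 2) = 1 := by
    have hexp : (-(5 : ℝ) * N / 2) + (5 : ℝ) * N / 2 = 0 := by ring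
    rw [← Real.rpow_add h0, hexp, Real.rpow_zero]
  calc (1 + ε₀) ^ (-(5 : ℝ) * N / 2) * (e N)⁻¹ * ((1 + ε₀) ^ ((5 : ℝ) * N / 2) * e N)
      = ((1 + ε₀) ^ (-(5 : ℝ) * N / 2) * (1 + ε₀) ^ ((5 : ℝ) * N / 2)) * ((e N)⁻¹ * e N) := by
        ring
    _ = 1 := by rw [hq, inv_mul_cancel₀ heN.ne', one_mul]

/-- Undoing the time rescaling: `t_N + (1+ε₀)^{-5N/2} e_N⁻¹ τ_k = t_{N+k}`.
[cite: Tao2016AveragedNS, §6.4 (6.82)] -/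
theorem time_add_rescScale_mul_rescTime (hε₀ : 0 < ε₀) (heN : 0 < e N) (k : ℤ) :
    t N + rescScale ε₀ e N * rescTime ε₀ t e N k = t (N + k) := by
  unfold rescTime
  have := rescScale_mul (N := N) hε₀ heN
  calc t N + rescScale ε₀ e N * ((1 + ε₀) ^ ((5 : ℝ) * N / 2) * e N * (t (N + k) - t N))
      = t N + rescScale ε₀ e N * ((1 + ε₀) ^ ((5 : ℝ) * N / 2) * e N) * (t (N + k) - t N) := by
        ring
    _ = t (N + k) := by rw [this]; ring

/-- `τ_0 = 0`. [cite: Tao2016AveragedNS, §6.4 (6.82)] -/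
theorem rescTime_zero (ε₀ : ℝ) (t e : ℤ → ℝ) (N : ℤ) : rescTime ε₀ t e N 0 = 0 := by
  simp [rescTime]

end Maps

section MulRpow

variable {ε₀ : ℝ}

/-- `(1+ε₀)^{-5N/2} e_N⁻¹ · (1+ε₀)^{5N/2} = e_N⁻¹`. [cite: Tao2016AveragedNS, §6.4 (6.82)] -/
theorem rescScale_mul_rpow (hε₀ : 0 < ε₀) (N : ℤ) (e : ℤ → ℝ) :
    rescScale ε₀ e N * (1 + ε₀) ^ ((5 : ℝ) * N / 2) = (e N)⁻¹ := by
  unfold rescScale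
  have h0 : (0 : ℝ) < 1 + ε₀ := by linarith
  have hq : (1 + ε₀) ^ (-(5 : ℝ) * N / 2) * (1 + ε₀) ^ ((5 : ℝ) * N / 2) = 1 := by
    have hexp : (-(5 : ℝ) * N / 2) + (5 : ℝ) * N / 2 = 0 := by ring
    rw [← Real.rpow_add h0, hexp, Real.rpow_zero]
  calc (1 + ε₀) ^ (-(5 : ℝ) * N / 2) * (e N)⁻¹ * (1 + ε₀) ^ ((5 : ℝ) * N / 2)
      = ((1 + ε₀) ^ (-(5 : ℝ) * N / 2) * (1 + ε₀) ^ ((5 : ℝ) * N / 2)) * (e N)⁻¹ := by ring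
    _ = (e N)⁻¹ := by rw [hq, one_mul]

end MulRpow


/-! ## Two more consequences of the checkpoint bounds -/

section Consequences

variable {γ ε₀ K ε : ℝ} {n₀ N : ℤ} {X : Fin 4 → ℤ → ℝ → ℝ} {E : ℤ → ℝ → ℝ} {t e : ℤ → ℝ}

/-- The checkpoint times increase: `t_m ≤ t_n` for `n₀ ≤ m ≤ n ≤ N`.
[cite: Tao2016AveragedNS, §6.2 Prop. 6.3] -/
theorem BlowupCheckpointsWith.time_mono (h : BlowupCheckpointsWith γ ε₀ K ε n₀ N X E t e)
    {m n : ℤ} (hm : n₀ ≤ m) (hmn : m ≤ n) (hn : n ≤ N) : t m ≤ t n := by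
  induction n, hmn using Int.leInduction with
  | base => exact le_rfl
  | succ n hmn ih =>
    have hs := (h.step (n + 1) (by omega) hn).lt
    simp only [add_sub_cancel_right] at hs
    exact (ih (by omega)).trans hs.le

/-- **The amplitude ratios (6.84)**: `(1+ε₀)^{-(n-m)/100} ≤ e_n/e_m ≤ (1+ε₀)^{(n-m)/100}` for
`n₀ ≤ m ≤ n ≤ N`, from (6.13). [cite: Tao2016AveragedNS, §6.4 (6.84)] -/
theorem BlowupCheckpointsWith.amp_ratio (h : BlowupCheckpointsWith γ ε₀ K ε n₀ N X E t e)
    (hε₀ : 0 < ε₀) {m n : ℤ} (hm : n₀ ≤ m) (hmn : m ≤ n) (hn : n ≤ N) :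
    e n ≤ (1 + ε₀) ^ (((n : ℝ) - m) / 100) * e m ∧
      e m ≤ (1 + ε₀) ^ (((n : ℝ) - m) / 100) * e n := by
  induction n, hmn using Int.leInduction with
  | base => simp
  | succ n hmn ih =>
    obtain ⟨ih1, ih2⟩ := ih (by omega)
    have hs := h.step (n + 1) (by omega) hn
    have h0 : (0 : ℝ) < 1 + ε₀ := by linarith
    have hq : 0 < (1 + ε₀) ^ ((1 : ℝ) / 100) := Real.rpow_pos_of_pos h0 _
    have hem : 0 < e m := h.amp_pos hm (by omega)
    have hexp : (((n + 1 : ℤ) : ℝ) - m) / 100 = (1 : ℝ) / 100 + ((n : ℝ) - m) / 100 := by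
      push_cast; ring
    rw [hexp, Real.rpow_add h0]
    have hge := hs.amp_ge
    have hle := hs.amp_le
    simp only [add_sub_cancel_right] at hge hle
    have hinv : e n ≤ (1 + ε₀) ^ ((1 : ℝ) / 100) * e (n + 1) := by
      have hmul : (1 + ε₀) ^ ((1 : ℝ) / 100) * (1 + ε₀) ^ (-(1 : ℝ) / 100) = 1 := by
        rw [← Real.rpow_add h0]; norm_num
      calc e n = (1 + ε₀) ^ ((1 : ℝ) / 100) * ((1 + ε₀) ^ (-(1 : ℝ) / 100) * e n) := by
            rw [← mul_assoc, hmul, one_mul]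
        _ ≤ (1 + ε₀) ^ ((1 : ℝ) / 100) * e (n + 1) := by gcongr
    constructor
    · calc e (n + 1) ≤ (1 + ε₀) ^ ((1 : ℝ) / 100) * e n := hle
        _ ≤ (1 + ε₀) ^ ((1 : ℝ) / 100) * ((1 + ε₀) ^ (((n : ℝ) - m) / 100) * e m) := by gcongr
        _ = (1 + ε₀) ^ ((1 : ℝ) / 100) * (1 + ε₀) ^ (((n : ℝ) - m) / 100) * e m := by ring
    · calc e m ≤ (1 + ε₀) ^ (((n : ℝ) - m) / 100) * e n := ih2
        _ ≤ (1 + ε₀) ^ (((n : ℝ) - m) / 100) * ((1 + ε₀) ^ ((1 : ℝ) / 100) * e (n + 1)) := by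
            gcongr
        _ = (1 + ε₀) ^ ((1 : ℝ) / 100) * (1 + ε₀) ^ (((n : ℝ) - m) / 100) * e (n + 1) := by ring

end Consequences

section Gap

variable {γ ε₀ K ε : ℝ} {n₀ N : ℤ} {X : Fin 4 → ℤ → ℝ → ℝ} {E : ℤ → ℝ → ℝ} {t e : ℤ → ℝ}

/-- **The geometric series behind (6.53)**: for `0 ≤ d` with `n₀ ≤ N - d`,
`(1+ε₀)^{5N/2} e_N (t_N - t_{N-d}) ≤ C₃(ε₀) (ρ^d - 1)`, `ρ = (1+ε₀)^{5/2+1/100}`, from the lifespan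
bound (6.14) and (6.84). [cite: Tao2016AveragedNS, §6.4 p. 34] -/
theorem BlowupCheckpointsWith.time_gap_le (h : BlowupCheckpointsWith γ ε₀ K ε n₀ N X E t e) (hε₀ : 0 < ε₀)
    (d : ℕ) (hd : n₀ ≤ N - d) :
    (1 + ε₀) ^ ((5 : ℝ) * N / 2) * e N * (t N - t (N - d)) ≤
      tauConst ε₀ * (((1 + ε₀) ^ ((5 : ℝ) / 2 + 1 / 100)) ^ d - 1) := by
  have h0 : (0 : ℝ) < 1 + ε₀ := by linarith
  set ρ : ℝ := (1 + ε₀) ^ ((5 : ℝ) / 2 + 1 / 100) with hρ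
  have hC := tauConst_mul_sub_one hε₀
  rw [← hρ] at hC
  induction d with
  | zero => simp
  | succ d ih =>
    have ih' := ih (by push_cast at hd ⊢; omega)
    -- the step `N - d`, from `t_{N-d-1}` to `t_{N-d}`
    have hs := h.step (N - d) (by push_cast at hd ⊢; omega) (by omega)
    have hlife := hs.life_le
    have heN : 0 < e N := h.amp_pos (by omega) le_rfl
    have hej : 0 < e (N - d - 1) := h.amp_pos (by push_cast at hd ⊢; omega) (by omega)
    -- `e_N ≤ (1+ε₀)^{(d+1)/100} e_{N-d-1}`
    have hrat := (h.amp_ratio hε₀ (m := N - d - 1) (n := N) (by push_cast at hd ⊢; omega)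
      (by omega) le_rfl).1
    have hcast1 : ((N : ℝ) - ((N - d - 1 : ℤ) : ℝ)) / 100 = ((d : ℝ) + 1) / 100 := by
      push_cast; ring
    rw [hcast1] at hrat
    have hcast2 : (-(5 : ℝ) * (((N - d : ℤ) : ℝ) - 1) / 2) =
        (5 : ℝ) * ((d : ℝ) + 1) / 2 - (5 : ℝ) * N / 2 := by
      push_cast; ring
    rw [hcast2, Real.rpow_sub h0] at hlife
    have hsub : ((N - (d + 1 : ℕ) : ℤ)) = N - d - 1 := by push_cast; ring
    rw [hsub]
    -- the new increment is at most `100 ρ^{d+1}`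
    have hinc : (1 + ε₀) ^ ((5 : ℝ) * N / 2) * e N * (t (N - d) - t (N - d - 1)) ≤
        100 * ρ ^ (d + 1) := by
      have hA : 0 < (1 + ε₀) ^ ((5 : ℝ) * N / 2) := Real.rpow_pos_of_pos h0 _
      have hB : 0 < (1 + ε₀) ^ ((5 : ℝ) * ((d : ℝ) + 1) / 2) := Real.rpow_pos_of_pos h0 _
      have hρpow : ρ ^ (d + 1) =
          (1 + ε₀) ^ ((5 : ℝ) * ((d : ℝ) + 1) / 2) * (1 + ε₀) ^ (((d : ℝ) + 1) / 100) := by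
        rw [hρ, ← Real.rpow_natCast, ← Real.rpow_mul h0.le, ← Real.rpow_add h0]
        congr 1; push_cast; ring
      calc (1 + ε₀) ^ ((5 : ℝ) * N / 2) * e N * (t (N - d) - t (N - d - 1))
          ≤ (1 + ε₀) ^ ((5 : ℝ) * N / 2) * e N *
              (100 * ((1 + ε₀) ^ ((5 : ℝ) * ((d : ℝ) + 1) / 2) / (1 + ε₀) ^ ((5 : ℝ) * N / 2)) *
                (e (N - d - 1))⁻¹) := by gcongr
        _ = 100 * (1 + ε₀) ^ ((5 : ℝ) * ((d : ℝ) + 1) / 2) * (e N * (e (N - d - 1))⁻¹) := by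
            field_simp
        _ ≤ 100 * (1 + ε₀) ^ ((5 : ℝ) * ((d : ℝ) + 1) / 2) *
              ((1 + ε₀) ^ (((d : ℝ) + 1) / 100) * e (N - d - 1) * (e (N - d - 1))⁻¹) := by
            gcongr
        _ = 100 * ρ ^ (d + 1) := by
            rw [mul_inv_cancel_right₀ hej.ne', hρpow]; ring
    have hρ1 : 1 ≤ ρ := (Real.one_lt_rpow (by linarith) (by norm_num)).le
    have hρd : 0 ≤ ρ ^ d := by positivity
    calc (1 + ε₀) ^ ((5 : ℝ) * N / 2) * e N * (t N - t (N - d - 1))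
        = (1 + ε₀) ^ ((5 : ℝ) * N / 2) * e N * (t N - t (N - d)) +
            (1 + ε₀) ^ ((5 : ℝ) * N / 2) * e N * (t (N - d) - t (N - d - 1)) := by ring
      _ ≤ tauConst ε₀ * (ρ ^ d - 1) + 100 * ρ ^ (d + 1) := add_le_add ih' hinc
      _ = tauConst ε₀ * (ρ ^ (d + 1) - 1) := by
          rw [pow_succ]; linear_combination (-(ρ ^ d)) * hC

end Gap

section Maps2

/-- The affine time change maps `[τ₀, +∞)` into `[0, +∞)` when `t₀ + λ τ₀ = 0`, `λ > 0`. [folklore] -/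
theorem mapsTo_affine {t₀ lam τ₀ : ℝ} (hlam : 0 < lam) (h0 : t₀ + lam * τ₀ = 0) :
    MapsTo (fun u => t₀ + lam * u) (Ici τ₀) (Ici 0) := by
  intro u hu
  simp only [mem_Ici] at hu ⊢
  show (0 : ℝ) ≤ t₀ + lam * u
  have : t₀ + lam * u = lam * (u - τ₀) := by linear_combination h0
  rw [this]
  exact mul_nonneg hlam.le (sub_nonneg.2 hu)

/-- Regularity transfers under the rescaling. [folklore] -/
theorem contDiffOn_rescale {f : ℝ → ℝ} {t₀ lam τ₀ : ℝ} (c : ℝ) (hlam : 0 < lam)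
    (h0 : t₀ + lam * τ₀ = 0) (hf : ContDiffOn ℝ 1 f (Ici 0)) :
    ContDiffOn ℝ 1 (fun u => c * f (t₀ + lam * u)) (Ici τ₀) := by
  have h1 : ContDiffOn ℝ 1 (fun u : ℝ => t₀ + lam * u) (Ici τ₀) := by fun_prop
  exact contDiffOn_const.mul (hf.comp h1 (mapsTo_affine hlam h0))

/-- The chain rule for the rescaling, one-sided derivatives:
`∂_u (c f(t₀ + λu)) = c λ f′(t₀ + λ u)` within `[τ₀, +∞)`. [folklore] -/
theorem hasDerivWithinAt_rescale {f : ℝ → ℝ} {t₀ lam τ₀ : ℝ} (c : ℝ) (hlam : 0 < lam)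
    (h0 : t₀ + lam * τ₀ = 0) (hf : ContDiffOn ℝ 1 f (Ici 0)) {s : ℝ} (hs : τ₀ ≤ s) :
    HasDerivWithinAt (fun u => c * f (t₀ + lam * u))
      (c * lam * derivWithin f (Ici 0) (t₀ + lam * s)) (Ici τ₀) s := by
  have hmaps := mapsTo_affine hlam h0
  have hp : (0 : ℝ) ≤ t₀ + lam * s := hmaps (mem_Ici.2 hs)
  have hfd : HasDerivWithinAt f (derivWithin f (Ici 0) (t₀ + lam * s)) (Ici 0) (t₀ + lam * s) :=
    ((hf.differentiableOn one_ne_zero) _ (mem_Ici.2 hp)).hasDerivWithinAt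
  have haff : HasDerivWithinAt (fun u => t₀ + lam * u) lam (Ici τ₀) s := by
    have h1 : HasDerivAt (fun u => t₀ + lam * u) lam s := by
      simpa using ((hasDerivAt_id s).const_mul lam).const_add t₀
    exact h1.hasDerivWithinAt
  have hcomp := (hfd.comp s haff hmaps).const_mul c
  refine (hcomp.congr_deriv (by ring)).congr_of_eventuallyEq ?_ ?_
  · exact Filter.Eventually.of_forall fun _ => rfl
  · rfl

/-- `derivWithin` form of `hasDerivWithinAt_rescale`. [folklore] -/
theorem derivWithin_rescale {f : ℝ → ℝ} {t₀ lam τ₀ : ℝ} (c : ℝ) (hlam : 0 < lam)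
    (h0 : t₀ + lam * τ₀ = 0) (hf : ContDiffOn ℝ 1 f (Ici 0)) {s : ℝ} (hs : τ₀ ≤ s) :
    derivWithin (fun u => c * f (t₀ + lam * u)) (Ici τ₀) s =
      c * lam * derivWithin f (Ici 0) (t₀ + lam * s) :=
  (hasDerivWithinAt_rescale c hlam h0 hf hs).derivWithin (uniqueDiffOn_Ici τ₀ s (mem_Ici.2 hs))

/-- Change of variables in the cumulative energy:
`∫_{τ₀}^{s} c f(t₀ + λ u) du = c λ⁻¹ ∫_0^{t₀+λs} f`. [folklore] -/
theorem integral_rescale {f : ℝ → ℝ} {t₀ lam τ₀ : ℝ} (c : ℝ) (hlam : 0 < lam)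
    (h0 : t₀ + lam * τ₀ = 0) (s : ℝ) :
    ∫ u in τ₀..s, c * f (t₀ + lam * u) = c * lam⁻¹ * ∫ x in (0 : ℝ)..(t₀ + lam * s), f x := by
  rw [intervalIntegral.integral_const_mul, intervalIntegral.integral_comp_add_mul _ hlam.ne', h0,
    smul_eq_mul, mul_assoc]

end Maps2

/-- The algebra of the rescaling of one equation of motion: if `∂Y = cλ ∂X`, `λQ = c` and the
main terms satisfy `M_Y = c² M_X`, then `|∂Y - Q_k M_Y| = cλ |∂X - Q Q_k M_X|`. [folklore] -/
theorem abs_rescale_le {DY DX lam c Qk Q MY MX err : ℝ} (hc : 0 < c) (hlam : 0 < lam)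
    (hD : DY = c * lam * DX) (hmul : lam * Q = c) (hM : MY = c ^ 2 * MX)
    (hX : |DX - Q * Qk * MX| ≤ err) : |DY - Qk * MY| ≤ c * lam * err := by
  have : DY - Qk * MY = c * lam * (DX - Q * Qk * MX) := by
    rw [hD, hM]; linear_combination (c * Qk * MX) * hmul
  rw [this, abs_mul, abs_of_pos (mul_pos hc hlam)]
  exact mul_le_mul_of_nonneg_left hX (mul_pos hc hlam).le

/-! ## Prop. 6.5 (i)–(ix) for the rescaled solution -/

section Hypotheses

variable {γ ε₀ K ε C₁ C₂ : ℝ} {n₀ N : ℤ} {X : Fin 4 → ℤ → ℝ → ℝ} {E : ℤ → ℝ → ℝ} {t e : ℤ → ℝ}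

/-- **The weight of the rescaled error terms** ("from (6.13), (6.12) we have
`e_N⁻¹ ≤ (1+ε₀)^{(N-n₀)/100}` and hence `(1+ε₀)^{2k-N/2} e_N⁻¹ ≤ (1+ε₀)^{2k-n₀/2}`", p. 34):
`(1+ε₀)^{-5N/2} e_N⁻¹ (1+ε₀)^{2(N+k)} ≤ (1+ε₀)^{2k-n₀/2}`. [cite: Tao2016AveragedNS, §6.4 p. 34] -/
theorem BlowupCheckpointsWith.rescScale_mul_rpow_le (h : BlowupCheckpointsWith γ ε₀ K ε n₀ N X E t e)
    (hε₀ : 0 < ε₀) (hN : n₀ ≤ N) (k : ℤ) :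
    rescScale ε₀ e N * (1 + ε₀) ^ ((2 : ℝ) * ((N + k : ℤ) : ℝ)) ≤
      (1 + ε₀) ^ ((2 : ℝ) * k - n₀ / 2) := by
  have h0 : (0 : ℝ) < 1 + ε₀ := by linarith
  have h1 : (1 : ℝ) ≤ 1 + ε₀ := by linarith
  have heN := h.rpow_le_amp hε₀ hN le_rfl
  have hpos : 0 < (1 + ε₀) ^ (-((N : ℝ) - n₀) / 100) := Real.rpow_pos_of_pos h0 _
  have hinv : (e N)⁻¹ ≤ (1 + ε₀) ^ (((N : ℝ) - n₀) / 100) := by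
    calc (e N)⁻¹ ≤ ((1 + ε₀) ^ (-((N : ℝ) - n₀) / 100))⁻¹ := inv_anti₀ hpos heN
      _ = (1 + ε₀) ^ (((N : ℝ) - n₀) / 100) := by
          rw [← Real.rpow_neg h0.le]; congr 1; ring
  have hNr : (n₀ : ℝ) ≤ N := by exact_mod_cast hN
  unfold rescScale
  calc (1 + ε₀) ^ (-(5 : ℝ) * N / 2) * (e N)⁻¹ * (1 + ε₀) ^ ((2 : ℝ) * ((N + k : ℤ) : ℝ))
      ≤ (1 + ε₀) ^ (-(5 : ℝ) * N / 2) * (1 + ε₀) ^ (((N : ℝ) - n₀) / 100) *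
          (1 + ε₀) ^ ((2 : ℝ) * ((N + k : ℤ) : ℝ)) := by gcongr
    _ = (1 + ε₀) ^ (-(5 : ℝ) * N / 2 + ((N : ℝ) - n₀) / 100 + (2 : ℝ) * ((N + k : ℤ) : ℝ)) := by
        rw [Real.rpow_add h0, Real.rpow_add h0]
    _ ≤ (1 + ε₀) ^ ((2 : ℝ) * k - n₀ / 2) := by
        apply Real.rpow_le_rpow_of_exponent_le h1
        push_cast
        linarith

/-- **The hypotheses of Prop. 6.5 from (6.1)–(6.27)_γ by rescaling** (Tao, §6.4, p. 59 of
arXiv v3: "Under this rescaling, the a priori regularity (6.43), (6.44) follows from (6.1), (6.2).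
The bound (6.84) … follows from (6.13) and (6.83); from this, (6.14), (6.82) and summing the
geometric series we then obtain (6.53) … This gives the equations of motion (6.45)–(6.48). The
energy inequality (6.49) is similarly obtained from rescaling (6.7). The initial conditions (6.50)
follow from rescaling (6.8) (and also using (6.11)). Similarly, (6.51) follows from rescaling
(6.9), and (6.52) follows from rescaling (6.10). Similarly, the conditions (6.54)–(6.63) follow
from rescaling (6.15)–(6.24). Finally, (6.64)–(6.66) follow from rescaling (6.25)–(6.27) and
using (6.84)"), with the implied constants `C₁, C₂` of (6.3)–(6.6), (6.9) and `C₃ = tauConst ε₀`.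
[cite: Tao2016AveragedNS, §6.4 p. 59] -/
theorem TaoODESystem.rescaledHypotheses (hsol : TaoODESystem ε₀ K ε C₁ C₂ n₀ X E)
    (h : BlowupCheckpointsWith γ ε₀ K ε n₀ N X E t e) (hε₀ : 0 < ε₀) (hN : n₀ ≤ N) (hC₁ : 0 ≤ C₁)
    (hC₂ : 0 ≤ C₂) :
    RescaledHypotheses γ ε₀ K ε C₁ C₂ (tauConst ε₀) n₀ N (rescTime ε₀ t e N) (rescMode ε₀ t e N X)
      (rescEnergy ε₀ t e N E) := by
  have h0q : (0 : ℝ) < 1 + ε₀ := by linarith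
  have heN : 0 < e N := h.amp_pos hN le_rfl
  have hc : 0 < (e N)⁻¹ := inv_pos.2 heN
  set lam := rescScale ε₀ e N with hlam_def
  have hlam : 0 < lam := rescScale_pos hε₀ heN
  have hmulQ : lam * (1 + ε₀) ^ ((5 : ℝ) * N / 2) = (e N)⁻¹ := rescScale_mul_rpow hε₀ N e
  set τ₀ := rescTime ε₀ t e N (n₀ - N) with hτ₀_def
  have hτ₀ : t N + lam * τ₀ = 0 := by
    rw [hτ₀_def, hlam_def, time_add_rescScale_mul_rescTime hε₀ heN]
    have : N + (n₀ - N) = n₀ := by ring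
    rw [this, h.t_init]
  have hmaps := mapsTo_affine hlam hτ₀
  have hp : ∀ {s : ℝ}, τ₀ ≤ s → 0 ≤ t N + lam * s := fun hs => hmaps (mem_Ici.2 hs)
  have hw := h.rescScale_mul_rpow_le hε₀ hN
  have hsplit : ∀ k : ℤ, (1 + ε₀) ^ ((5 : ℝ) * ((N + k : ℤ) : ℝ) / 2) =
      (1 + ε₀) ^ ((5 : ℝ) * N / 2) * (1 + ε₀) ^ ((5 : ℝ) * k / 2) := by
    intro k; rw [← Real.rpow_add h0q]; congr 1; push_cast; ring
  -- the common estimate of the error terms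
  have herr : ∀ (k : ℤ) (s : ℝ), τ₀ ≤ s →
      (e N)⁻¹ * lam * (C₁ * (1 + ε₀) ^ ((2 : ℝ) * ((N + k : ℤ) : ℝ)) *
        Real.sqrt (E (N + k) (t N + lam * s))) ≤
      C₁ * (1 + ε₀) ^ ((2 : ℝ) * k - n₀ / 2) * Real.sqrt (rescEnergy ε₀ t e N E k s) := by
    intro k s hs
    have hsq : Real.sqrt (rescEnergy ε₀ t e N E k s) =
        (e N)⁻¹ * Real.sqrt (E (N + k) (t N + lam * s)) := by
      show Real.sqrt ((e N)⁻¹ ^ 2 * E (N + k) (t N + lam * s)) = _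
      rw [Real.sqrt_mul (sq_nonneg _), Real.sqrt_sq hc.le]
    rw [hsq]
    have hE : 0 ≤ Real.sqrt (E (N + k) (t N + lam * s)) := Real.sqrt_nonneg _
    calc (e N)⁻¹ * lam * (C₁ * (1 + ε₀) ^ ((2 : ℝ) * ((N + k : ℤ) : ℝ)) *
          Real.sqrt (E (N + k) (t N + lam * s)))
        = C₁ * (lam * (1 + ε₀) ^ ((2 : ℝ) * ((N + k : ℤ) : ℝ))) *
            ((e N)⁻¹ * Real.sqrt (E (N + k) (t N + lam * s))) := by ring
      _ ≤ C₁ * (1 + ε₀) ^ ((2 : ℝ) * k - n₀ / 2) *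
            ((e N)⁻¹ * Real.sqrt (E (N + k) (t N + lam * s))) := by gcongr; exact hw k
  have hQ : 0 < (1 + ε₀) ^ ((5 : ℝ) * N / 2) * e N := mul_pos (Real.rpow_pos_of_pos h0q _) heN
  have hst := h.state N hN le_rfl
  -- the point `t_N + λ s` lies in `[t_{N+k-1}, t_{N+k}]` when `s ∈ [τ_{k-1}, τ_k]`
  have hseg : ∀ k : ℤ, ∀ s ∈ Icc (rescTime ε₀ t e N (k - 1)) (rescTime ε₀ t e N k),
      t N + lam * s ∈ Icc (t (N + k - 1)) (t (N + k)) := by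
    intro k s hs
    constructor
    · calc t (N + k - 1) = t (N + (k - 1)) := by ring_nf
        _ = t N + lam * rescTime ε₀ t e N (k - 1) :=
            (time_add_rescScale_mul_rescTime hε₀ heN (k - 1)).symm
        _ ≤ t N + lam * s := by have := hs.1; nlinarith
    · calc t N + lam * s ≤ t N + lam * rescTime ε₀ t e N k := by have := hs.2; nlinarith
        _ = t (N + k) := time_add_rescScale_mul_rescTime hε₀ heN k
  -- `(e_{N+k-1}/e_N)² ≤ (1+ε₀)^{|k-1|/50}` for `n₀ < N + k ≤ N`
  have hsq : ∀ k : ℤ, n₀ - N < k → k ≤ 0 →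
      (e N)⁻¹ ^ 2 * e (N + k - 1) ^ 2 ≤ (1 + ε₀) ^ (|(k : ℝ) - 1| / 50) := by
    intro k hk hk0
    have hrat := (h.amp_ratio hε₀ (m := N + k - 1) (n := N) (by omega) (by omega) le_rfl).2
    have hek : 0 < e (N + k - 1) := h.amp_pos (by omega) (by omega)
    have hkr : (k : ℝ) ≤ 0 := by exact_mod_cast hk0
    have habs : |(k : ℝ) - 1| = 1 - k := by
      rw [abs_of_nonpos (by linarith)]; ring
    have hexp : ((N : ℝ) - ((N + k - 1 : ℤ) : ℝ)) / 100 = (1 - (k : ℝ)) / 100 := by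
      push_cast; ring
    rw [hexp] at hrat
    have hle : (e N)⁻¹ * e (N + k - 1) ≤ (1 + ε₀) ^ ((1 - (k : ℝ)) / 100) := by
      rw [inv_mul_le_iff₀ heN]; linarith [hrat]
    have hnn : 0 ≤ (e N)⁻¹ * e (N + k - 1) := by positivity
    calc (e N)⁻¹ ^ 2 * e (N + k - 1) ^ 2 = ((e N)⁻¹ * e (N + k - 1)) ^ 2 := by ring
      _ ≤ ((1 + ε₀) ^ ((1 - (k : ℝ)) / 100)) ^ 2 := pow_le_pow_left₀ hnn hle 2
      _ = (1 + ε₀) ^ (|(k : ℝ) - 1| / 50) := by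
          rw [← Real.rpow_natCast, ← Real.rpow_mul h0q.le, habs]; congr 1; push_cast; ring
  refine
    { tau_zero := rescTime_zero ε₀ t e N
      tau_lt := ?_
      contDiffOn_Y := fun i k => contDiffOn_rescale _ hlam hτ₀ (hsol.contDiffOn_X i (N + k))
      contDiffOn_F := fun k => contDiffOn_rescale _ hlam hτ₀ (hsol.contDiffOn_E (N + k))
      nonneg_F := fun k s hs => mul_nonneg (sq_nonneg _) (hsol.nonneg_E _ _ (hp hs))
      apriori_Y := ?_
      apriori_F := ?_
      eq1 := ?_
      eq2 := ?_
      eq3 := ?_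
      eq4 := ?_
      energy := ?_
      init_Y := ?_
      init_F := ?_
      defect_lower := ?_
      defect_upper := ?_
      noLow_Y := fun i k s hk hs => by
        show (e N)⁻¹ * X i (N + k) (t N + lam * s) = 0
        rw [hsol.noLow_X i (N + k) _ (by omega) (hp hs), mul_zero]
      noLow_F := fun k s hk hs => by
        show (e N)⁻¹ ^ 2 * E (N + k) (t N + lam * s) = 0
        rw [hsol.noLow_E (N + k) _ (by omega) (hp hs), mul_zero]
      tau_ge := ?_
      tau_le := ?_
      a_eq := ?_
      b_abs_le := ?_
      c_abs_le := ?_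
      c_ge := ?_
      d_abs_le := ?_
      energy_prev_le := ?_
      b_prev_ge := ?_
      b_prev_le := ?_
      c_prev_ge := ?_
      c_prev_le := ?_
      en_before := ?_
      en_during := ?_
      en_after := ?_ }
  · intro k hk hk0
    have hlt := (h.step (N + k) (by omega) (by omega)).lt
    unfold rescTime
    have e1 : N + (k - 1) = N + k - 1 := by ring
    rw [e1]
    have : t (N + k - 1) - t N < t (N + k) - t N := by linarith
    exact mul_lt_mul_of_pos_left this hQ
  · -- (6.43)
    intro T _hT
    obtain ⟨M, hM⟩ := hsol.apriori_X (|t N + lam * T| + 1) (by positivity)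
    refine ⟨(e N)⁻¹ * (1 + (1 + ε₀) ^ (-(10 : ℝ) * N)) * (4 * M), fun s hs k => ?_⟩
    have hps : 0 ≤ t N + lam * s := hp hs.1
    have hpT : t N + lam * s ≤ |t N + lam * T| + 1 := by
      have h1 : t N + lam * s ≤ t N + lam * T := by have := hs.2; nlinarith
      exact h1.trans ((le_abs_self _).trans (by linarith))
    have hMi := fun i => hM _ ⟨hps, hpT⟩ i (N + k)
    have hprod : (1 + ε₀) ^ (-(10 : ℝ) * N) * (1 + ε₀) ^ ((10 : ℝ) * ((N + k : ℤ) : ℝ)) =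
        (1 + ε₀) ^ ((10 : ℝ) * k) := by
      rw [← Real.rpow_add h0q]; congr 1; push_cast; ring
    have hA : 1 + (1 + ε₀) ^ ((10 : ℝ) * k) ≤
        (1 + (1 + ε₀) ^ (-(10 : ℝ) * N)) * (1 + (1 + ε₀) ^ ((10 : ℝ) * ((N + k : ℤ) : ℝ))) := by
      rw [← hprod]
      nlinarith [Real.rpow_pos_of_pos h0q (-(10 : ℝ) * N),
        Real.rpow_pos_of_pos h0q ((10 : ℝ) * ((N + k : ℤ) : ℝ))]
    show (1 + (1 + ε₀) ^ ((10 : ℝ) * k)) * (|(e N)⁻¹ * X 0 (N + k) (t N + lam * s)| +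
      |(e N)⁻¹ * X 1 (N + k) (t N + lam * s)| + |(e N)⁻¹ * X 2 (N + k) (t N + lam * s)| +
        |(e N)⁻¹ * X 3 (N + k) (t N + lam * s)|) ≤ _
    simp only [abs_mul, abs_of_pos hc]
    have ha0 := abs_nonneg (X 0 (N + k) (t N + lam * s))
    have ha1 := abs_nonneg (X 1 (N + k) (t N + lam * s))
    have ha2 := abs_nonneg (X 2 (N + k) (t N + lam * s))
    have ha3 := abs_nonneg (X 3 (N + k) (t N + lam * s))
    calc (1 + (1 + ε₀) ^ ((10 : ℝ) * k)) *
          ((e N)⁻¹ * |X 0 (N + k) (t N + lam * s)| + (e N)⁻¹ * |X 1 (N + k) (t N + lam * s)| +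
            (e N)⁻¹ * |X 2 (N + k) (t N + lam * s)| + (e N)⁻¹ * |X 3 (N + k) (t N + lam * s)|)
        = (1 + (1 + ε₀) ^ ((10 : ℝ) * k)) * ((e N)⁻¹ * (|X 0 (N + k) (t N + lam * s)| +
            |X 1 (N + k) (t N + lam * s)| + |X 2 (N + k) (t N + lam * s)| +
              |X 3 (N + k) (t N + lam * s)|)) := by ring
      _ ≤ (1 + (1 + ε₀) ^ (-(10 : ℝ) * N)) * (1 + (1 + ε₀) ^ ((10 : ℝ) * ((N + k : ℤ) : ℝ))) *
            ((e N)⁻¹ * (|X 0 (N + k) (t N + lam * s)| + |X 1 (N + k) (t N + lam * s)| +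
              |X 2 (N + k) (t N + lam * s)| + |X 3 (N + k) (t N + lam * s)|)) := by gcongr
      _ = (e N)⁻¹ * (1 + (1 + ε₀) ^ (-(10 : ℝ) * N)) *
            ((1 + (1 + ε₀) ^ ((10 : ℝ) * ((N + k : ℤ) : ℝ))) * |X 0 (N + k) (t N + lam * s)| +
              (1 + (1 + ε₀) ^ ((10 : ℝ) * ((N + k : ℤ) : ℝ))) * |X 1 (N + k) (t N + lam * s)| +
              (1 + (1 + ε₀) ^ ((10 : ℝ) * ((N + k : ℤ) : ℝ))) * |X 2 (N + k) (t N + lam * s)| +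
              (1 + (1 + ε₀) ^ ((10 : ℝ) * ((N + k : ℤ) : ℝ))) * |X 3 (N + k) (t N + lam * s)|) := by
          ring
      _ ≤ (e N)⁻¹ * (1 + (1 + ε₀) ^ (-(10 : ℝ) * N)) * (4 * M) := by
          gcongr; linarith [hMi 0, hMi 1, hMi 2, hMi 3]
  · -- (6.44)
    intro T _hT
    obtain ⟨M, hM⟩ := hsol.apriori_E (|t N + lam * T| + 1) (by positivity)
    refine ⟨(e N)⁻¹ * (1 + (1 + ε₀) ^ (-(10 : ℝ) * N)) * M, fun s hs k => ?_⟩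
    have hps : 0 ≤ t N + lam * s := hp hs.1
    have hpT : t N + lam * s ≤ |t N + lam * T| + 1 := by
      have h1 : t N + lam * s ≤ t N + lam * T := by have := hs.2; nlinarith
      exact h1.trans ((le_abs_self _).trans (by linarith))
    have hMk := hM _ ⟨hps, hpT⟩ (N + k)
    have hprod : (1 + ε₀) ^ (-(10 : ℝ) * N) * (1 + ε₀) ^ ((10 : ℝ) * ((N + k : ℤ) : ℝ)) =
        (1 + ε₀) ^ ((10 : ℝ) * k) := by
      rw [← Real.rpow_add h0q]; congr 1; push_cast; ring
    have hA : 1 + (1 + ε₀) ^ ((10 : ℝ) * k) ≤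
        (1 + (1 + ε₀) ^ (-(10 : ℝ) * N)) * (1 + (1 + ε₀) ^ ((10 : ℝ) * ((N + k : ℤ) : ℝ))) := by
      rw [← hprod]
      nlinarith [Real.rpow_pos_of_pos h0q (-(10 : ℝ) * N),
        Real.rpow_pos_of_pos h0q ((10 : ℝ) * ((N + k : ℤ) : ℝ))]
    have hsq : Real.sqrt (rescEnergy ε₀ t e N E k s) =
        (e N)⁻¹ * Real.sqrt (E (N + k) (t N + lam * s)) := by
      show Real.sqrt ((e N)⁻¹ ^ 2 * E (N + k) (t N + lam * s)) = _
      rw [Real.sqrt_mul (sq_nonneg _), Real.sqrt_sq hc.le]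
    have hS : 0 ≤ Real.sqrt (E (N + k) (t N + lam * s)) := Real.sqrt_nonneg _
    calc (1 + (1 + ε₀) ^ ((10 : ℝ) * k)) * Real.sqrt (rescEnergy ε₀ t e N E k s)
        = (1 + (1 + ε₀) ^ ((10 : ℝ) * k)) * ((e N)⁻¹ * Real.sqrt (E (N + k) (t N + lam * s))) := by
          rw [hsq]
      _ ≤ (1 + (1 + ε₀) ^ (-(10 : ℝ) * N)) * (1 + (1 + ε₀) ^ ((10 : ℝ) * ((N + k : ℤ) : ℝ))) *
            ((e N)⁻¹ * Real.sqrt (E (N + k) (t N + lam * s))) := by gcongr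
      _ = (e N)⁻¹ * (1 + (1 + ε₀) ^ (-(10 : ℝ) * N)) *
            ((1 + (1 + ε₀) ^ ((10 : ℝ) * ((N + k : ℤ) : ℝ))) *
              Real.sqrt (E (N + k) (t N + lam * s))) := by ring
      _ ≤ (e N)⁻¹ * (1 + (1 + ε₀) ^ (-(10 : ℝ) * N)) * M := by gcongr
  · -- (6.45)
    intro k s hs
    have hd := derivWithin_rescale (e N)⁻¹ hlam hτ₀ (hsol.contDiffOn_X 0 (N + k)) hs
    have hX := hsol.eq1 (N + k) (t N + lam * s) (hp hs)
    rw [hsplit k] at hX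
    have e1 : N + k - 1 = N + (k - 1) := by ring
    rw [e1] at hX
    refine (abs_rescale_le hc hlam hd hmulQ ?_ hX).trans (herr k s hs)
    simp only [rescMode]; ring
  · -- (6.46)
    intro k s hs
    have hd := derivWithin_rescale (e N)⁻¹ hlam hτ₀ (hsol.contDiffOn_X 1 (N + k)) hs
    have hX := hsol.eq2 (N + k) (t N + lam * s) (hp hs)
    rw [hsplit k] at hX
    refine (abs_rescale_le hc hlam hd hmulQ ?_ hX).trans (herr k s hs)
    simp only [rescMode]; ring
  · -- (6.47)
    intro k s hs
    have hd := derivWithin_rescale (e N)⁻¹ hlam hτ₀ (hsol.contDiffOn_X 2 (N + k)) hs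
    have hX := hsol.eq3 (N + k) (t N + lam * s) (hp hs)
    rw [hsplit k] at hX
    refine (abs_rescale_le hc hlam hd hmulQ ?_ hX).trans (herr k s hs)
    simp only [rescMode]; ring
  · -- (6.48)
    intro k s hs
    have hd := derivWithin_rescale (e N)⁻¹ hlam hτ₀ (hsol.contDiffOn_X 3 (N + k)) hs
    have hX := hsol.eq4 (N + k) (t N + lam * s) (hp hs)
    rw [hsplit k] at hX
    have e1 : N + k + 1 = N + (k + 1) := by ring
    rw [e1] at hX
    refine (abs_rescale_le hc hlam hd hmulQ ?_ hX).trans (herr k s hs)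
    simp only [rescMode]; ring
  · -- (6.49)
    intro k s hs
    have hd := derivWithin_rescale ((e N)⁻¹ ^ 2) hlam hτ₀ (hsol.contDiffOn_E (N + k)) hs
    have hX := hsol.energy (N + k) (t N + lam * s) (hp hs)
    have hsplit' : (1 + ε₀) ^ ((5 : ℝ) * (((N + k : ℤ) : ℝ) + 1) / 2) =
        (1 + ε₀) ^ ((5 : ℝ) * N / 2) * (1 + ε₀) ^ ((5 : ℝ) * k / 2) *
          (1 + ε₀) ^ ((5 : ℝ) / 2) := by
      rw [← Real.rpow_add h0q, ← Real.rpow_add h0q]; congr 1; push_cast; ring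
    rw [hsplit k, hsplit'] at hX
    have e1 : N + k - 1 = N + (k - 1) := by ring
    have e2 : N + k + 1 = N + (k + 1) := by ring
    rw [e1, e2] at hX
    change derivWithin (fun u => (e N)⁻¹ ^ 2 * E (N + k) (t N + lam * u)) (Ici τ₀) s ≤ _
    rw [hd]
    simp only [rescMode]
    have hcl : 0 ≤ (e N)⁻¹ ^ 2 * lam := by positivity
    refine (mul_le_mul_of_nonneg_left hX hcl).trans_eq ?_
    linear_combination (K * (1 + ε₀) ^ ((5 : ℝ) * k / 2) *
      (X 3 (N + (k - 1)) (t N + lam * s) ^ 2 * X 0 (N + k) (t N + lam * s) -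
        (1 + ε₀) ^ ((5 : ℝ) / 2) * X 3 (N + k) (t N + lam * s) ^ 2 *
          X 0 (N + (k + 1)) (t N + lam * s)) * (e N)⁻¹ ^ 2) * hmulQ
  · -- (6.50), modes
    intro i k hk
    show (e N)⁻¹ * X i (N + k) (t N + lam * τ₀) = 0
    rw [hτ₀, hsol.init_X, if_neg, mul_zero]
    rintro ⟨-, h2⟩
    omega
  · -- (6.50), energies
    intro k hk
    show (e N)⁻¹ ^ 2 * E (N + k) (t N + lam * τ₀) = 0
    rw [hτ₀, hsol.init_E, if_neg, mul_zero]
    omega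
  · -- (6.51), lower
    intro k s hs
    have hX := hsol.defect_lower (N + k) (t N + lam * s) (hp hs)
    show (1 / 2) * ∑ i, ((e N)⁻¹ * X i (N + k) (t N + lam * s)) ^ 2 ≤
      (e N)⁻¹ ^ 2 * E (N + k) (t N + lam * s)
    simp only [Fin.sum_univ_four] at hX ⊢
    nlinarith [hX, sq_nonneg (e N)⁻¹]
  · -- (6.51), upper
    intro k s hs
    have hX := hsol.defect_upper (N + k) (t N + lam * s) (hp hs)
    have hI : ∫ u in τ₀..s, rescEnergy ε₀ t e N E k u =
        (e N)⁻¹ ^ 2 * lam⁻¹ * ∫ x in (0 : ℝ)..(t N + lam * s), E (N + k) x := by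
      show (∫ u in τ₀..s, (e N)⁻¹ ^ 2 * E (N + k) (t N + lam * u)) = _
      exact integral_rescale _ hlam hτ₀ s
    have hInn : 0 ≤ ∫ u in τ₀..s, rescEnergy ε₀ t e N E k u :=
      intervalIntegral.integral_nonneg hs fun u hu =>
        mul_nonneg (sq_nonneg _) (hsol.nonneg_E _ _ (hp hu.1))
    have hI' : ∫ x in (0 : ℝ)..(t N + lam * s), E (N + k) x =
        (e N) ^ 2 * lam * ∫ u in τ₀..s, rescEnergy ε₀ t e N E k u := by
      rw [hI]; field_simp
    rw [hI'] at hX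
    show (e N)⁻¹ ^ 2 * E (N + k) (t N + lam * s) ≤
      (1 / 2) * ∑ i, ((e N)⁻¹ * X i (N + k) (t N + lam * s)) ^ 2 +
        C₂ * (1 + ε₀) ^ ((2 : ℝ) * k - n₀ / 2) * ∫ u in τ₀..s, rescEnergy ε₀ t e N E k u
    simp only [Fin.sum_univ_four] at hX ⊢
    have hwk := hw k
    calc (e N)⁻¹ ^ 2 * E (N + k) (t N + lam * s)
        ≤ (e N)⁻¹ ^ 2 * ((1 / 2) * (X 0 (N + k) (t N + lam * s) ^ 2 +
            X 1 (N + k) (t N + lam * s) ^ 2 + X 2 (N + k) (t N + lam * s) ^ 2 +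
              X 3 (N + k) (t N + lam * s) ^ 2) +
            C₂ * (1 + ε₀) ^ ((2 : ℝ) * ((N + k : ℤ) : ℝ)) *
              ((e N) ^ 2 * lam * ∫ u in τ₀..s, rescEnergy ε₀ t e N E k u)) :=
          mul_le_mul_of_nonneg_left hX (sq_nonneg _)
      _ = (1 / 2) * (((e N)⁻¹ * X 0 (N + k) (t N + lam * s)) ^ 2 +
            ((e N)⁻¹ * X 1 (N + k) (t N + lam * s)) ^ 2 +
              ((e N)⁻¹ * X 2 (N + k) (t N + lam * s)) ^ 2 +
                ((e N)⁻¹ * X 3 (N + k) (t N + lam * s)) ^ 2) +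
            C₂ * (lam * (1 + ε₀) ^ ((2 : ℝ) * ((N + k : ℤ) : ℝ))) *
              ∫ u in τ₀..s, rescEnergy ε₀ t e N E k u := by
          field_simp
      _ ≤ _ := by gcongr
  
  · intro k hk hk0
    obtain ⟨d, rfl⟩ : ∃ d : ℕ, k = -(d : ℤ) := ⟨(-k).toNat, by omega⟩
    have hb := h.time_gap_le hε₀ d (by omega)
    have habs : |((-(d : ℤ) : ℤ) : ℝ)| = d := by
      push_cast; rw [abs_neg, Nat.abs_cast]
    rw [habs]
    have hρd : (1 + ε₀) ^ (((5 : ℝ) / 2 + 1 / 100) * (d : ℝ)) =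
        ((1 + ε₀) ^ ((5 : ℝ) / 2 + 1 / 100)) ^ d := by
      rw [Real.rpow_mul h0q.le, Real.rpow_natCast]
    rw [hρd]
    unfold rescTime
    have e1 : N + -(d : ℤ) = N - d := by ring
    rw [e1]
    nlinarith [hb, tauConst_nonneg hε₀]
  · intro k hk hk0
    have hmono := h.time_mono (m := N + k) (n := N) (by omega) (by omega) le_rfl
    unfold rescTime
    exact mul_nonpos_of_nonneg_of_nonpos hQ.le (by linarith)
  · show (e N)⁻¹ * X 0 (N + 0) (t N + lam * 0) = 1
    rw [add_zero, mul_zero, add_zero, hst.x1_eq, inv_mul_cancel₀ heN.ne']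
  · show |(e N)⁻¹ * X 1 (N + 0) (t N + lam * 0)| ≤ _
    rw [add_zero, mul_zero, add_zero, abs_mul, abs_of_pos hc]
    calc (e N)⁻¹ * |X 1 N (t N)| ≤ (e N)⁻¹ * (1 / 10 ^ 5 * ε * e N) := by
          gcongr; exact hst.x2_abs_le
      _ = 1 / 10 ^ 5 * ε := by field_simp
  · show |(e N)⁻¹ * X 2 (N + 0) (t N + lam * 0)| ≤ _
    rw [add_zero, mul_zero, add_zero, abs_mul, abs_of_pos hc]
    calc (e N)⁻¹ * |X 2 N (t N)| ≤ (e N)⁻¹ * (γ * ε ^ 2 * e N) := by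
          gcongr; exact hst.x3_abs_le
      _ = γ * ε ^ 2 := by field_simp
  · show -(1 + ε₀) ^ (-(n₀ : ℝ) / 4) ≤ (e N)⁻¹ * X 2 (N + 0) (t N + lam * 0)
    rw [add_zero, mul_zero, add_zero, le_inv_mul_iff₀ heN]
    linarith [hst.x3_ge]
  · show |(e N)⁻¹ * X 3 (N + 0) (t N + lam * 0)| ≤ _
    rw [add_zero, mul_zero, add_zero, abs_mul, abs_of_pos hc]
    calc (e N)⁻¹ * |X 3 N (t N)| ≤ (e N)⁻¹ * ((K ^ 10)⁻¹ * e N) := by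
          gcongr; exact hst.x4_abs_le
      _ = (K ^ 10)⁻¹ := by field_simp
  · show (e N)⁻¹ ^ 2 * E (N + -1) (t N + lam * 0) ≤ _
    have e1 : N + -1 = N - 1 := by ring
    rw [mul_zero, add_zero, e1]
    calc (e N)⁻¹ ^ 2 * E (N - 1) (t N) ≤ (e N)⁻¹ ^ 2 * ((K ^ 20)⁻¹ * e N ^ 2) := by
          gcongr; exact hst.energy_prev_le
      _ = (K ^ 20)⁻¹ := by field_simp
  · intro hn
    have hsp := h.step N hn le_rfl
    show 1 / 10 ^ 5 * ε ≤ (e N)⁻¹ * X 1 (N + -1) (t N + lam * 0)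
    have e1 : N + -1 = N - 1 := by ring
    rw [mul_zero, add_zero, e1, le_inv_mul_iff₀ heN]
    linarith [hsp.x2_prev_ge]
  · intro hn
    have hsp := h.step N hn le_rfl
    show (e N)⁻¹ * X 1 (N + -1) (t N + lam * 0) ≤ 10 ^ 5 * ε
    have e1 : N + -1 = N - 1 := by ring
    rw [mul_zero, add_zero, e1, inv_mul_le_iff₀ heN]
    linarith [hsp.x2_prev_le]
  · intro hn
    have hsp := h.step N hn le_rfl
    show Real.exp (K ^ 9) * ε ^ 2 ≤ (e N)⁻¹ * X 2 (N + -1) (t N + lam * 0)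
    have e1 : N + -1 = N - 1 := by ring
    rw [mul_zero, add_zero, e1, le_inv_mul_iff₀ heN]
    linarith [hsp.x3_prev_ge]
  · intro hn
    have hsp := h.step N hn le_rfl
    show (e N)⁻¹ * X 2 (N + -1) (t N + lam * 0) ≤ Real.exp (K ^ 10) * ε ^ 2
    have e1 : N + -1 = N - 1 := by ring
    rw [mul_zero, add_zero, e1, inv_mul_le_iff₀ heN]
    linarith [hsp.x3_prev_le]
  · intro k hk hk0 m hm s hs
    have hp := hseg k s hs
    have hb := (h.step (N + k) (by omega) (by omega)).en_before m hm _ hp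
    show (e N)⁻¹ ^ 2 * E (N + (k - m)) (t N + lam * s) ≤ _
    have e1 : N + (k - (m : ℤ)) = N + k - m := by ring
    rw [e1, Real.rpow_add h0q]
    have hK : 0 ≤ (K ^ 10)⁻¹ * (1 + ε₀) ^ ((m : ℝ) / 10) := by positivity
    calc (e N)⁻¹ ^ 2 * E (N + k - m) (t N + lam * s)
        ≤ (e N)⁻¹ ^ 2 * ((K ^ 10)⁻¹ * (1 + ε₀) ^ ((m : ℝ) / 10) * e (N + k - 1) ^ 2) := by
          gcongr
      _ = (K ^ 10)⁻¹ * (1 + ε₀) ^ ((m : ℝ) / 10) * ((e N)⁻¹ ^ 2 * e (N + k - 1) ^ 2) := by ring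
      _ ≤ (K ^ 10)⁻¹ * (1 + ε₀) ^ ((m : ℝ) / 10) * (1 + ε₀) ^ (|(k : ℝ) - 1| / 50) :=
          mul_le_mul_of_nonneg_left (hsq k hk hk0) hK
      _ = _ := by ring
  · intro k hk hk0 s hs
    have hp := hseg k s hs
    have hb := (h.step (N + k) (by omega) (by omega)).en_during _ hp
    show (e N)⁻¹ ^ 2 * E (N + (k - 1)) (t N + lam * s) + (e N)⁻¹ ^ 2 * E (N + k) (t N + lam * s) ≤ _
    have e1 : N + (k - 1) = N + k - 1 := by ring
    rw [e1]
    calc (e N)⁻¹ ^ 2 * E (N + k - 1) (t N + lam * s) + (e N)⁻¹ ^ 2 * E (N + k) (t N + lam * s)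
        = (e N)⁻¹ ^ 2 * (E (N + k - 1) (t N + lam * s) + E (N + k) (t N + lam * s)) := by ring
      _ ≤ (e N)⁻¹ ^ 2 * e (N + k - 1) ^ 2 := by gcongr
      _ ≤ _ := hsq k hk hk0
  · intro k hk hk0 m hm s hs
    have hp := hseg k s hs
    have hb := (h.step (N + k) (by omega) (by omega)).en_after m hm _ hp
    show (e N)⁻¹ ^ 2 * E (N + (k + m)) (t N + lam * s) ≤ _
    have e1 : N + (k + (m : ℤ)) = N + k + m := by ring
    rw [e1, Real.rpow_add h0q]
    have hK : 0 ≤ (K ^ 30)⁻¹ * (1 + ε₀) ^ (-(10 : ℝ) * m) := by positivity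
    calc (e N)⁻¹ ^ 2 * E (N + k + m) (t N + lam * s)
        ≤ (e N)⁻¹ ^ 2 * ((K ^ 30)⁻¹ * (1 + ε₀) ^ (-(10 : ℝ) * m) * e (N + k - 1) ^ 2) := by
          gcongr
      _ = (K ^ 30)⁻¹ * (1 + ε₀) ^ (-(10 : ℝ) * m) * ((e N)⁻¹ ^ 2 * e (N + k - 1) ^ 2) := by ring
      _ ≤ (K ^ 30)⁻¹ * (1 + ε₀) ^ (-(10 : ℝ) * m) * (1 + ε₀) ^ (|(k : ℝ) - 1| / 50) :=
          mul_le_mul_of_nonneg_left (hsq k hk hk0) hK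
      _ = _ := by ring

end Hypotheses

/-! ## Undoing the rescaling: from `(τ₁, μ₁)` to `(t_{N+1}, e_{N+1})` -/

section Unscale

variable {γ ε₀ K ε : ℝ} {n₀ N : ℤ} {X : Fin 4 → ℤ → ℝ → ℝ} {E : ℤ → ℝ → ℝ} {t e : ℤ → ℝ}


/-- **(6.69)–(6.74) at scale `1` for the rescaled solution give (6.30)–(6.35) at scale `N+1`**
with `t_{N+1} := t_N + (1+ε₀)^{-5N/2} e_N⁻¹ τ₁`, `e_{N+1} := μ₁ e_N` (Tao, §6.4, p. 34: "It is then
routine to verify that the conclusions of Proposition 6.4 are satisfied").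
[cite: Tao2016AveragedNS, §6.4 p. 34] -/
theorem StateBoundsWith.unscale (heN : 0 < e N) {τ₁ μ₁ : ℝ}
    (hst : StateBoundsWith γ ε₀ K ε n₀ (rescMode ε₀ t e N X) (rescEnergy ε₀ t e N E) 1 τ₁ μ₁) :
    StateBoundsWith γ ε₀ K ε n₀ X E (N + 1) (t N + rescScale ε₀ e N * τ₁) (e N * μ₁) := by
  have hc : 0 < (e N)⁻¹ := inv_pos.2 heN
  set lam := rescScale ε₀ e N with hlam_def
  have hμ := hst.pos
  have h1 : X 0 (N + 1) (t N + lam * τ₁) = e N * μ₁ := by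
    have := hst.x1_eq
    change (e N)⁻¹ * X 0 (N + 1) (t N + lam * τ₁) = μ₁ at this
    rw [← this, mul_inv_cancel_left₀ heN.ne']
  have h2 := hst.x2_abs_le
  have h3 := hst.x3_abs_le
  have h3' := hst.x3_ge
  have h4 := hst.x4_abs_le
  have h5 := hst.energy_prev_le
  change |(e N)⁻¹ * X 1 (N + 1) (t N + lam * τ₁)| ≤ _ at h2
  change |(e N)⁻¹ * X 2 (N + 1) (t N + lam * τ₁)| ≤ _ at h3
  change _ ≤ (e N)⁻¹ * X 2 (N + 1) (t N + lam * τ₁) at h3'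
  change |(e N)⁻¹ * X 3 (N + 1) (t N + lam * τ₁)| ≤ _ at h4
  change (e N)⁻¹ ^ 2 * E (N + (1 - 1)) (t N + lam * τ₁) ≤ _ at h5
  rw [abs_mul, abs_of_pos hc, inv_mul_le_iff₀ heN] at h2 h3 h4
  rw [le_inv_mul_iff₀ heN] at h3'
  have e1 : N + (1 - 1) = N + 1 - 1 := by ring
  rw [e1] at h5
  refine ⟨mul_pos heN hμ, h1, by linarith, by linarith, by linarith, by linarith, ?_⟩
  have hsq : 0 < (e N) ^ 2 := by positivity
  calc E (N + 1 - 1) (t N + lam * τ₁)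
      = (e N) ^ 2 * ((e N)⁻¹ ^ 2 * E (N + 1 - 1) (t N + lam * τ₁)) := by field_simp
    _ ≤ (e N) ^ 2 * ((K ^ 20)⁻¹ * μ₁ ^ 2) := by gcongr
    _ = (K ^ 20)⁻¹ * (e N * μ₁) ^ 2 := by ring

/-- **(6.67)–(6.68), (6.75)–(6.81) at scale `1` for the rescaled solution give (6.28)–(6.29),
(6.36)–(6.42) at scale `N+1`** with `t_{N+1} := t_N + (1+ε₀)^{-5N/2} e_N⁻¹ τ₁`, `e_{N+1} := μ₁ e_N`.
[cite: Tao2016AveragedNS, §6.4 p. 34] -/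
theorem StepBounds.unscale (hε₀ : 0 < ε₀) (heN : 0 < e N) {τ₁ μ₁ : ℝ} (h100 : τ₁ ≤ 100)
    (hsp : StepBounds ε₀ K ε (rescMode ε₀ t e N X) (rescEnergy ε₀ t e N E) 1 0 τ₁ 1 μ₁) :
    StepBounds ε₀ K ε X E (N + 1) (t N) (t N + rescScale ε₀ e N * τ₁) (e N) (e N * μ₁) := by
  have h0q : (0 : ℝ) < 1 + ε₀ := by linarith
  have hc : 0 < (e N)⁻¹ := inv_pos.2 heN
  set lam := rescScale ε₀ e N with hlam_def
  have hlam : 0 < lam := rescScale_pos hε₀ heN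
  have hτ₁ : 0 < τ₁ := hsp.lt
  -- the time change `u ↦ t_N + λ u` maps `[0, τ₁]` onto `[t_N, t_N + λ τ₁]`
  have hback : ∀ t' ∈ Icc (t N) (t N + lam * τ₁),
      ∃ u ∈ Icc (0 : ℝ) τ₁, t' = t N + lam * u := by
    intro t' ht'
    refine ⟨lam⁻¹ * (t' - t N), ⟨?_, ?_⟩, ?_⟩
    · have := ht'.1; positivity
    · rw [inv_mul_le_iff₀ hlam]; linarith [ht'.2]
    · field_simp; ring
  have hcastN : (((N + 1 : ℤ) : ℝ) - 1) = (N : ℝ) := by push_cast; ring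
  have hlamN : (1 + ε₀) ^ (-(5 : ℝ) * N / 2) * (e N)⁻¹ = lam := rfl
  have hx2 := hsp.x2_prev_ge
  have hx2' := hsp.x2_prev_le
  have hx3 := hsp.x3_prev_ge
  have hx3' := hsp.x3_prev_le
  change _ ≤ (e N)⁻¹ * X 1 (N + (1 - 1)) (t N + lam * τ₁) at hx2
  change (e N)⁻¹ * X 1 (N + (1 - 1)) (t N + lam * τ₁) ≤ _ at hx2'
  change _ ≤ (e N)⁻¹ * X 2 (N + (1 - 1)) (t N + lam * τ₁) at hx3
  change (e N)⁻¹ * X 2 (N + (1 - 1)) (t N + lam * τ₁) ≤ _ at hx3'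
  have e1 : N + (1 - 1) = N + 1 - 1 := by ring
  rw [e1, le_inv_mul_iff₀ heN] at hx2 hx3
  rw [e1, inv_mul_le_iff₀ heN] at hx2' hx3'
  have hlife := hsp.life_ge
  have hampg := hsp.amp_ge
  have hampl := hsp.amp_le
  simp only [Int.cast_one, sub_self, mul_zero, zero_div, Real.rpow_zero, inv_one, mul_one,
    sub_zero] at hlife hampg hampl
  refine
    { lt := by nlinarith
      amp_ge := by nlinarith
      amp_le := by nlinarith
      life_ge := ?_
      life_le := ?_
      x2_prev_ge := by linarith
      x2_prev_le := by linarith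
      x3_prev_ge := by linarith
      x3_prev_le := by linarith
      en_before := ?_
      en_during := ?_
      en_after := ?_ }
  · rw [hcastN, mul_assoc, hlamN]; nlinarith
  · rw [hcastN, mul_assoc, hlamN]; nlinarith
  · intro m hm t' ht'
    obtain ⟨u, hu, rfl⟩ := hback t' ht'
    have hb := hsp.en_before m hm u hu
    change (e N)⁻¹ ^ 2 * E (N + (1 - m)) (t N + lam * u) ≤ _ at hb
    have e2 : N + (1 - (m : ℤ)) = N + 1 - m := by ring
    rw [e2] at hb
    calc E (N + 1 - m) (t N + lam * u)
        = (e N) ^ 2 * ((e N)⁻¹ ^ 2 * E (N + 1 - m) (t N + lam * u)) := by field_simp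
      _ ≤ (e N) ^ 2 * ((K ^ 10)⁻¹ * (1 + ε₀) ^ ((m : ℝ) / 10) * 1 ^ 2) := by gcongr
      _ = (K ^ 10)⁻¹ * (1 + ε₀) ^ ((m : ℝ) / 10) * e N ^ 2 := by ring
  · intro t' ht'
    obtain ⟨u, hu, rfl⟩ := hback t' ht'
    have hb := hsp.en_during u hu
    change (e N)⁻¹ ^ 2 * E (N + (1 - 1)) (t N + lam * u) +
      (e N)⁻¹ ^ 2 * E (N + 1) (t N + lam * u) ≤ _ at hb
    rw [e1] at hb
    calc E (N + 1 - 1) (t N + lam * u) + E (N + 1) (t N + lam * u)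
        = (e N) ^ 2 * ((e N)⁻¹ ^ 2 * E (N + 1 - 1) (t N + lam * u) +
            (e N)⁻¹ ^ 2 * E (N + 1) (t N + lam * u)) := by field_simp
      _ ≤ (e N) ^ 2 * 1 ^ 2 := by gcongr
      _ = e N ^ 2 := by ring
  · intro m hm t' ht'
    obtain ⟨u, hu, rfl⟩ := hback t' ht'
    have hb := hsp.en_after m hm u hu
    change (e N)⁻¹ ^ 2 * E (N + (1 + m)) (t N + lam * u) ≤ _ at hb
    have e2 : N + (1 + (m : ℤ)) = N + 1 + m := by ring
    rw [e2] at hb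
    calc E (N + 1 + m) (t N + lam * u)
        = (e N) ^ 2 * ((e N)⁻¹ ^ 2 * E (N + 1 + m) (t N + lam * u)) := by field_simp
      _ ≤ (e N) ^ 2 * ((K ^ 30)⁻¹ * (1 + ε₀) ^ (-(10 : ℝ) * m) * 1 ^ 2) := by gcongr
      _ = (K ^ 30)⁻¹ * (1 + ε₀) ^ (-(10 : ℝ) * m) * e N ^ 2 := by ring

end Unscale



/-! ## Proposition 6.4_γ (and hence Thm. 6.2) from Proposition 6.5_γ -/

/-- **Prop. 6.5_γ (with `C₃` before `K₀`) ⇒ Prop. 6.4_γ** (Tao, §6.4, p. 59): rescale by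
(6.82)–(6.84), apply Prop. 6.5 with `C₃ = tauConst ε₀` and the implied constants `C₁, C₂` of
(6.3)–(6.6), (6.9), and set `t_{N+1} := t_N + (1+ε₀)^{-5N/2} e_N⁻¹ τ₁`, `e_{N+1} := μ₁ e_N`.
[cite: Tao2016AveragedNS, §6.4 p. 59] -/
theorem blowupDynamicsStepWith_of_rescaledStepWith' {γ : ℝ → ℝ} (h : rescaledStepWith' γ) :
    blowupDynamicsStepWith γ := by
  intro ε₀ hε₀ hε₀1
  obtain ⟨K₀, hK⟩ := h ε₀ hε₀ hε₀1 (tauConst ε₀) (tauConst_nonneg hε₀)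
  refine ⟨K₀, fun K hK₀K hKpos => ?_⟩
  obtain ⟨e₀, he₀, hε⟩ := hK K hK₀K hKpos
  refine ⟨e₀, he₀, fun ε hεpos hεle C₁ C₂ hC₁ hC₂ => ?_⟩
  obtain ⟨N₀, hN⟩ := hε ε hεpos hεle C₁ C₂ hC₁ hC₂
  refine ⟨N₀, fun n₀ hn₀ X E hsol N hNn t e hce => ?_⟩
  have heN : 0 < e N := hce.amp_pos hNn le_rfl
  have hε₀' : -1 < ε₀ := by linarith
  obtain ⟨τ₁, μ₁, hconc⟩ := hN n₀ hn₀ N hNn (rescTime ε₀ t e N) (rescMode ε₀ t e N X)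
    (rescEnergy ε₀ t e N E) (hsol.rescaledHypotheses hce hε₀ hNn hC₁ hC₂)
  exact ⟨_, _, (hconc.stateBoundsWith hε₀').unscale heN,
    hconc.stepBounds.unscale hε₀ heN hconc.tau_le⟩

/-- **Prop. 6.5_γ (uniform in `C₃`, `rescaledStepWith`) ⇒ Prop. 6.4_γ.**
[cite: Tao2016AveragedNS, §6.4 p. 59] -/
theorem blowupDynamicsStepWith_of_rescaledStepWith {γ : ℝ → ℝ} (h : rescaledStepWith γ) :
    blowupDynamicsStepWith γ :=
  blowupDynamicsStepWith_of_rescaledStepWith' h.weaken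

/-- **Thm. 6.2 from Prop. 6.5_γ (`C₃` before `K₀`), `γ ≥ 0`.** [cite: Tao2016AveragedNS, §6.2–6.4] -/
theorem noGlobalODESolution_of_rescaledStepWith' {γ : ℝ → ℝ} (hγ : ∀ K, 0 < K → 0 ≤ γ K)
    (h : rescaledStepWith' γ) : noGlobalODESolution :=
  noGlobalODESolution_of_blowupDynamicsStepWith hγ (blowupDynamicsStepWith_of_rescaledStepWith' h)

/-- **Thm. 6.2 from the corrected Prop. 6.5 with `C₃` before `K₀`** — the dischargeable route.
[cite: Tao2016AveragedNS, §6.2–6.4] -/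
theorem noGlobalODESolution_of_rescaledStepCorrected' (h : rescaledStepCorrected') :
    noGlobalODESolution :=
  noGlobalODESolution_of_rescaledStepWith' (fun K _ => by positivity) h

/-- **Thm. 6.2 from the corrected-coefficient instance of the uniform schema `rescaledStepWith`**
(the body of the deprecated closed name `rescaledStepCorrected` of `TaoCascadeRescaled.lean`, spelled
out). [cite: Tao2016AveragedNS, §6.2–6.4] -/
theorem noGlobalODESolution_of_rescaledStepCorrected
    (h : rescaledStepWith fun K => 1 / 10 ^ 5 * Real.exp (-K ^ 10 / 2)) : noGlobalODESolution :=
  noGlobalODESolution_of_rescaledStepCorrected' (rescaledStepCorrected.weaken h)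

/-- **The printed Props. 6.3/6.4 from the corrected Prop. 6.5 with `C₃` before `K₀`** (through
Thm. 6.2, `blowupDynamics_iff_noGlobalODESolution`). [cite: Tao2016AveragedNS, §6.2–6.4] -/
theorem blowupDynamics_of_rescaledStepCorrected' (h : rescaledStepCorrected') :
    blowupDynamics ∧ blowupDynamicsStep :=
  ⟨blowupDynamics_iff_noGlobalODESolution.2 (noGlobalODESolution_of_rescaledStepCorrected' h),
    blowupDynamicsStep_of_noGlobalODESolution (noGlobalODESolution_of_rescaledStepCorrected' h)⟩

end TaoCascade

end Literature.Analysis.FluidPDE
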